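import Mathlib.Analysis.InnerProductSpace.PiL2
import Mathlib.MeasureTheory.Integral.IntervalIntegral.Basic
import Mathlib.MeasureTheory.Integral.Bochner.Basic
import Mathlib.MeasureTheory.Measure.Haar.InnerProductSpace
import Mathlib.Analysis.SpecialFunctions.Exp
import Literature.Analysis.FluidPDE.LerayProjector
import HarnessLib

/-!
# Barrier: finite-time blow-up of COMPLEX-valued solutions of 3D Navier–Stokes (Li–Sinai 2008)

Barrier catalogue entry for `NavierStokesRegularity` (D-0021). Vendors, as a named fact stated on
the Fourier side exactly as the source works, the blow-up of Dong Li and Ya. G. Sinai, *Blow ups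
of complex solutions of the 3D Navier–Stokes system and renormalization group method*, J. Eur.
Math. Soc. 10 (2008), 267–313, in the form of its consequence spelled out in §1 and §10 (the Main
Theorem of §9 is an asymptotic description of the expansion coefficients from which §10 derives the
blow-up). Vocabulary: Mathlib, plus the accepted Fourier-side Leray symbol `Literature.Analysis.FluidPDE.leraySymbol`
(`Literature/Analysis/FluidPDE/LerayProjector.lean`: `P̂(k) w = w - |k|⁻² ⟪k, w⟫ k`, junk `id` at
`k = 0`), which is exactly Li–Sinai's `P_k`.

## What is printed

* §1, eq. (1): writing the Fourier transform of the unknown `u(x,t)` as `-i v(k,t)`, the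
  Navier–Stokes system on `ℝ³` with viscosity `1` and no force becomes
  `v(k,t) = exp{-t|k|²} v(k,0) + ∫₀ᵗ exp{-(t-s)|k|²} ds · ∫_{ℝ³} ⟨v(k-k',s), k⟩ · P_k v(k',s) dk'`,
  `P_k v = v - ⟨v,k⟩k/⟨k,k⟩` the projection orthogonal to `k`; incompressibility is
  `⟨v(k,t), k⟩ = 0` for `k ≠ 0`.
* §1: "we consider (1) in the space of real-valued functions `v(k,t)`. Certainly this does not mean
  that `iv(k,t)` is the Fourier transform of a real-valued vector field. For such solutions the
  energy inequality does not hold." The data `v(k,0)` are bounded functions supported in a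
  neighbourhood of a point `(0,0,k⁽⁰⁾)`.
* §1 and §10: for the one-parameter families `v_A(k,0) = A v(k,0)` of the Main Theorem (§9,
  10-parameter families of initial conditions, an open set of them) there are critical values
  `A_cr = A_cr(t)` such that "the solution `v_{A_cr}(k,s)` blows up at `t` so that for `t' < t` both
  the energy and the enstrophy are finite while at `t' = t` they both become infinite";
  §10: `E(t') = O(1)/(Δt)⁵`, `Δt = t - t'`.
* Reception as a barrier: Tao 2016, §1.1 p. 5 ("finite time blowup was established … for a
  complexified version of the Navier–Stokes equations, in which the energy identity was …
  available but non-coercive"); Lemarié-Rieusset 2016, §11.2 p. 313 (complex NS rewritten as a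
  real system of the form (11.7); the book's reference [334] there is the follow-up D. Li,
  Ya. Sinai, Regul. Chaotic Dyn. 15 (2010), not the JEMS 2008 paper vendored here).

## Rendering

The fact asserts the existence of ONE blow-up solution of the printed integral equation (1): a
bounded, compactly supported, measurable, incompressible real datum `v₀ : ℝ³ → ℝ³`, a time
`t > 0` and `v : [0,t) × ℝ³ → ℝ³` with `v(0) = v₀` satisfying (1) at every `τ ∈ [0,t)` and every
`k ≠ 0` — with the `k'`-integrand integrable and the `s`-integrand interval-integrable, so that no
Bochner junk value is involved — whose energy `∫ |v(k,τ)|² dk` is finite for `τ < t` and tends to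
`∞` as `τ ↑ t`. This is implied by §1/§10 for the critical member of any admissible family. The
correspondence between (1) and the physical-space equations (normalisation of the Fourier
transform) is the authors' (§1) and is not restated.

## Audit (D-0021, 2026-08-16): technique class confirmed, evasions sharpened

The statement-level audit of 2026-08-14 is recorded in `ComplexNavierStokesBlowupProofs.lean`
(`LiSinaiCriticalEnergyBlowupNarrow`: what Theorem 1 of the source backs). The audit of
2026-08-16 attacked the `technique_class`/`blocks:` reading and CONFIRMS it — to block the class
"arguments valid verbatim for complex-valued solutions" one complex counterexample of any special
form suffices — while documenting how special the witnesses are, which is what the sharpened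
`evasions_known:`/`scope_caveats:` lines below record, at page level:

* the witnesses are FEED-FORWARD cascades of the Fourier half-space class
  `supp v(·,τ) ⊆ {k₃ ≥ a > 0}`: no real datum lies in it except `0`, and there the integral
  equation (1) is uniquely and globally solvable with the energy infinite only on a bounded set of
  times (in-tree theorems `LiSinai.seriesSolution_solvesFourierNSAt`,
  `SolvesFourierNSAt.unique_of_oneSided`, `LiSinai.seriesSolution_energy_lt_top_of_le` of the
  companion files); in print, every analytic nonlinear evolution equation — Navier–Stokes and Euler
  with arbitrary complex viscosities included — is globally well posed for such data in a space of
  Fourier-side distributions, and Li–Sinai's solution is "another and highly non-trivial example of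
  the global wellposedness beyond the classical blow-up" (Nakanishi–Wang 2025, Thm. 1.1–1.2
  pp. 4–5, §1.1 p. 4, §8.1 p. 45): the blow-up is the exit from `L²` of a globally defined
  cascade, not a breakdown of the Fourier-side dynamics;
* the proven witnesses (fixed point `H⁽⁰⁾ = -2(k₁, k₂)`, data (39): horizontal Fourier components
  radial) and their antisymmetrised real flows are "axial symmetric, with no swirl, or close to
  that", a class in which real blow-up "is therefore excluded" (Boldrighini–Frigio–Maponi–
  Pellegrinotti–Sinai 2023, §1 p. 107 and §3 p. 114, citing Lei–Zhang 2017); complex blow-up for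
  profiles with swirl or away from the fixed points is so far numerical only (ibid. §3 p. 116);
* the same renormalisation-group mechanism gives complex blow-up for the viscous Burgers system in
  `ℝⁿ`, `n ≥ 2`, whose real solutions are global by the maximum principle (source, §1 p. 269;
  Li–Sinai 2010): the barrier is insensitive to dimension and criticality and certifies only that
  SOME real-structure input is used — energy-class arguments are constrained by
  `TaoAveragedBlowup` and `EnergySupercriticality` instead.

## References

* D. Li, Ya. G. Sinai, J. Eur. Math. Soc. 10 (2008), 267–313. [`LiSinai2008`]
* T. Tao, J. Amer. Math. Soc. 29 (2016), §1.1. [`Tao2016AveragedNS`]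
* P. G. Lemarié-Rieusset, *The Navier–Stokes problem in the 21st century* (2016), §11.2.
  [`LemarieRieusset2016`]
* S. Montgomery-Smith, Proc. AMS 129 (2001). [`MontgomerySmith2001`]
* (audit 2026-08-16) K. Nakanishi, B. Wang, J. Funct. Anal. 289 (2025) 111004
  (arXiv:2401.09746), Thm. 1.1–1.2, §1.1, §5.1, §8.1. [`NakanishiWang2025`]
* (audit 2026-08-16) C. Boldrighini, S. Frigio, P. Maponi, A. Pellegrinotti, Ya. G. Sinai,
  Ensaios Mat. 38 (2023), §1 p. 107, §2 Prop. 2.1, §3 pp. 114–116. [`BoldrighiniEtAl2023`]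
* (audit 2026-08-16) C. Boldrighini, S. Frigio, P. Maponi, A. Pellegrinotti, Ya. G. Sinai,
  JETP 131 (2020) 356–360, §1 and §3. [`BoldrighiniEtAl2020`]
* (audit 2026-08-16) Z. Lei, Q. S. Zhang, Pacific J. Math. 289 (2017) 169–187, Thm. 1.2.
  [`LeiZhang2017`]
* (audit 2026-08-16) D. Li, Ya. G. Sinai, J. Math. Phys. 51 (2010) 015205. [`LiSinai2010Burgers2D`]
* (audit 2026-08-16) C. Boldrighini, S. Frigio, P. Maponi, IMA J. Appl. Math. 82 (2017) 697–716,
  §2. [`BoldrighiniFrigioMaponi2017`]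
-/

noncomputable section

open MeasureTheory Set Filter Topology
open scoped ENNReal InnerProductSpace RealInnerProductSpace

namespace Literature.Barriers.NavierStokesRegularity

/-- Local notation for Fourier space `ℝ³ = EuclideanSpace ℝ (Fin 3)`. -/
local notation "ℝ³" => EuclideanSpace ℝ (Fin 3)

/-- The bilinear Fourier-side Navier–Stokes interaction at wave vector `k` and time `s`
(the inner integrand of Li–Sinai 2008, (1)): `k' ↦ ⟨v(k-k',s), k⟩ · P_k v(k',s)`, with
`P_k = Literature.Fluid.leraySymbol k` (`P_k w = w - ⟨w,k⟩k/⟨k,k⟩`; junk `id` at `k = 0`, only `k ≠ 0` is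
used). [cite: LiSinai2008, §1 eq. (1)] -/
def fourierNSIntegrand (v : ℝ → ℝ³ → ℝ³) (s : ℝ) (k k' : ℝ³) : ℝ³ :=
  ⟪v s (k - k'), k⟫ • Literature.Analysis.FluidPDE.leraySymbol k (v s k')

/-- **`v` solves Li–Sinai's integral equation (1) at time `τ` and wave vector `k`**, with honest
integrals: for every `s ∈ (0,τ)` the `k'`-integrand is integrable, the Duhamel integrand
`s ↦ exp{-(τ-s)|k|²} ∫ ⟨v(k-k',s),k⟩ P_k v(k',s) dk'` is interval integrable on `[0,τ]`, and
`v(k,τ) = exp{-τ|k|²} v(k,0) + ∫₀^τ exp{-(τ-s)|k|²} (∫ ⟨v(k-k',s),k⟩ P_k v(k',s) dk') ds`.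
[cite: LiSinai2008, §1 eq. (1)] -/
def SolvesFourierNSAt (v : ℝ → ℝ³ → ℝ³) (τ : ℝ) (k : ℝ³) : Prop :=
  (∀ s ∈ Ioo 0 τ, Integrable (fourierNSIntegrand v s k)) ∧
  IntervalIntegrable (fun s => Real.exp (-(τ - s) * ‖k‖ ^ 2) • ∫ k', fourierNSIntegrand v s k k')
    volume 0 τ ∧
  v τ k = Real.exp (-τ * ‖k‖ ^ 2) • v 0 k +
    ∫ s in (0 : ℝ)..τ, Real.exp (-(τ - s) * ‖k‖ ^ 2) • ∫ k', fourierNSIntegrand v s k k'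

/-- **Barrier (Li–Sinai 2008): complex-valued solutions of 3D Navier–Stokes can blow up in
finite time.** There exist a bounded, measurable, compactly supported real datum
`v₀ : ℝ³ → ℝ³` on the Fourier side, incompressible (`⟨v₀(k), k⟩ = 0`), a time `t > 0` and a
solution `v` of Li–Sinai's Fourier-space Navier–Stokes integral equation (1) (viscosity `1`, no
force; `SolvesFourierNSAt` at every `τ ∈ [0,t)` and every `k ≠ 0`) with `v(0) = v₀` and
a.e.-measurable slices, whose energy `E(τ) = ∫ |v(k,τ)|² dk` is finite for every `τ < t` and tends
to `+∞` as `τ ↑ t` (the Fatou reading of "at `t' = t` they become infinite"). Since `v` is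
real but not conjugation-symmetric, `u = 𝓕⁻¹(-iv)` is a COMPLEX-valued velocity field, for which
the energy identity is not coercive. Rendered from §1 and §10 of the source (see the module
docstring). [cite: LiSinai2008, §1 (eq. (1) and the paragraph on critical values A_cr) and §10]

BARRIER (structured block, D-0021):
technique_class: complexification-insensitive fourier-side-algebra energy-sign-blind real-structure-insensitive formal-perturbation-series power-series-in-data
blocks: NavierStokesRegularity (`Literature.NS.NavierStokesExistenceSmoothR3`) by any argument that would apply verbatim to complex-valued solutions of the same equations — i.e. that uses the algebraic/Fourier structure of the Navier–Stokes nonlinearity and linear estimates but never the real-valuedness of `u` (the positivity making the energy identity coercive): such an argument would prove global regularity for Li–Sinai's complex solutions, which blow up [cite: LiSinai2008, §1 and §10]; recorded as a model blow-up "in which the energy identity was … available but non-coercive" [cite: Tao2016AveragedNS, §1.1 p. 5]. (audit 2026-08-16) One complex counterexample suffices to block this class, so the class is covered; but an argument is blocked ONLY if every one of its steps survives on Li–Sinai's witnesses, which are feed-forward cascades with Fourier support in a half-space `{k₃ ≥ a > 0}` (no real datum except `0` lies there [cite: NakanishiWang2025, §1.1 p. 4]) and with a leading profile whose horizontal Fourier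 components are radial (axisymmetric without swirl) [cite: LiSinai2008, §7 p. 295, eq. (39)] [cite: BoldrighiniEtAl2023, §3 p. 114]; a single use of `‖u(t)‖₂ ≤ ‖u₀‖₂`, of a maximum principle for a really-transported quantity, or of `û(-k) = conj û(k)` leaves the blocked class (see `evasions_known:`), and energy-class arguments are constrained by `TaoAveragedBlowup` / `EnergySupercriticality`, not by this entry.
because: for real Fourier data `v(k,0)` concentrated near a large wave vector `k⁽⁰⁾` the power series `v_A = Σ_p A^p g_p` in the amplitude `A` has coefficients `g_p` supported near `p k⁽⁰⁾`; a renormalisation-group analysis shows `g_p` converges, after rescaling, to a Gaussian-type fixed point with `p`-th power growth `Λ(s)^p`, so at the critical amplitude `A_cr = Λ(t)⁻¹` the modes `A^p g_p(·,t)` all have size `O(p)` on balls of size `O(√p)`, making energy and enstrophy infinite exactly at time `t` and finite before [cite: LiSinai2008, §1, §9 Main Theorem, §10].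
evasions_known: use real-valuedness — the coercive energy identity/inequality for real solutions ("For such solutions the energy inequality does not hold") [cite: LiSinai2008, §1]; but averaged REAL models obeying the energy identity also blow up, so real-valuedness must enter through more than the energy identity [cite: Tao2016AveragedNS, §1.1 Thm. 1.5]; related non-coercive toy models: cheap Navier–Stokes [cite: MontgomerySmith2001, Thm. 1] and the real-system rewriting of complex NS [cite: LemarieRieusset2016, §11.2]. (audit 2026-08-16) Three further real-structure inputs each of which already fails on the witnesses: (1) TWO-SIDEDNESS of the spectrum — the witnesses and all their Duhamel iterates live in a cone around the positive `k₃`-axis (`supp g_p ⊆ C + ⋯ + C`) [cite: LiSinai2008, §2 p. 270 and §7 p. 295], a Fourier half-space class containing no real datum but `0` [cite: NakanishiWang2025, §1.1 p. 4]; for the antisymmetrised (real) data the order-`p` terms centre at `ℓκ⁽⁰⁾` with `|ℓ| = O(√p)` instead of drifting to `pκ⁽⁰⁾`, and no blow-up is seen numerically [cite: BoldrighiniEtAl2020, §1 and §3], while a real renormalisation-group fixed point "remains unclear" [cite: LiSinai2008, §1 p. 269]; (2) REAL TRANSPORT / maximum-principle structure — the proven witnesses (fixed point `H⁽⁰⁾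 = -2(k₁,k₂)`) and their real counterparts are "axial symmetric, with no swirl, or close to that", a class where real blow-up "is therefore excluded" [cite: BoldrighiniEtAl2023, §1 p. 107 and §3 p. 114] by the no-swirl/small-swirl theory (transport of `ω_θ/r`; criticality of `Γ = r v^θ`) [cite: LeiZhang2017, Thm. 1.2]; the same mechanism yields complex blow-up for the viscous Burgers system in `ℝⁿ`, `n ≥ 2`, real-globally-regular by the maximum principle [cite: LiSinai2008, §1 p. 269] [cite: LiSinai2010Burgers2D]; (3) ANY coercive or feedback input at all — on the Fourier half-space every analytic nonlinear evolution equation, Navier–Stokes and Euler with arbitrary complex viscosities included, is globally well posed in a space of Fourier-side distributions ("the Fourier support … essentially eliminates all possible nonlinear feedback"), Li–Sinai's solution being "another and highly non-trivial example of the global wellposedness beyond the classical blow-up" [cite: NakanishiWang2025, Thm. 1.2 p. 5 and §8.1 p. 45]. Not an evasion: complexification-insensitive harmonic analysis restricted to data WITH swirl — complex blow-up for swirl profiles `H_α` and for non-fixed-point data is reported numerically [cite: BoldrighiniEtAl2023, §3 p. 116].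
scope_caveats: (a) the printed Main Theorem [cite: LiSinai2008, §9 (p. 311)] states asymptotics of the expansion coefficients `g_p`; the energy blow-up vendored here is DERIVED in an informal paragraph ("This immediately implies that at `t` the energy is infinite", "one can easily derive") [cite: LiSinai2008, §10 (p. 312)]; (b) enstrophy blow-up and the rates `E(t') = O(1)/(Δt)⁵`, `Ω(t') = O(1)/(Δt)⁷` are not vendored [cite: LiSinai2008, §1 (p. 268) and §10]; `Tendsto … (𝓝 ∞)` is the Fatou reading of "at `t' = t` they become infinite"; (c) COMPLEX (non-real) solutions only — real Fourier data `v(k,0)` without conjugation symmetry [cite: LiSinai2008, §1]; the fact fixes only bounded/measurable/compactly-supported Fourier data, so nothing is asserted about the smoothness/decay class of the physical datum `u₀ = 𝓕⁻¹(-iv₀)` with which the `blocks:` line implicitly compares the summit's Schwartz-type data; (d) the statement is on the Fourier side for the integral equation (1) as printed — the physical-space ↔ (1) correspondence (normalisation, `û = -iv`) is quoted, not formalised [cite: LiSinai2008, §1]; (e) parts of the printed argument are computer-numerical: "For all `p ≤ 50` all remainders were found numerically by computer", "Numerically it was shown that `ρ₁` can be chosen …", "`N` is the number of steps where the procedure was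 done numerically" — no interval-arithmetic error control is described in the text [cite: LiSinai2008, §7 (p. 295), §8 (p. 302) and §9 (list of constants, item 6)]; (f) the integrability and a.e.-measurability side conditions make the integrals honest (no junk values); being extra conjuncts inside the existential they make the formal claim slightly STRONGER than the bare identity (1), and are satisfied by the printed solution, whose modes are bounded with Gaussian-type decay before the critical time [cite: LiSinai2008, §9 Main Theorem]; (g) (audit 2026-08-14, `ComplexNavierStokesBlowupProofs.lean`) "finite energy at every `τ < t`" is the printed SENTENCE, not a consequence of Theorem 1, which tunes the data parameters `b(s)` to the time `s` [cite: LiSinai2008, Thm. 1 p. 311 and §10 p. 312]; what Theorem 1 backs is `LiSinaiCriticalEnergyBlowupNarrow`, giving this fact back up to one right-accumulation scenario; off-tuning growth along the unstable directions is the factor `(1 + α_j/p)` per step, i.e. polynomial in `p` [cite: LiSinai2008, §9 p. 310]; (h) (audit 2026-08-16) NATURE of the blow-up: the witness solution of (1) exists for all times, is unique among one-sided solutions and has finite energy again after a bounded window of times (in-tree `LiSinai.seriesSolution_solvesFourierNSAt`, `SolvesFourierNSAt.unique_of_oneSided`, `LiSinai.seriesSolution_energy_lt_top_of_le`; in print [cite: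 NakanishiWang2025, §5.1 and §8.1 p. 45]) — what becomes infinite at `t` is the `L²` (and `Ḣ¹`) norm of `û(·,t)`, so physical-space smoothness with finite energy is lost, which is the Clay-relevant sense, while "the solution `v(k,t)` tends pointwise to a finite limit as `t ↑ τ`" [cite: BoldrighiniEtAl2023, §2 p. 114]; (i) (audit 2026-08-16) the printed rates disagree across the literature: `E(t') = O(1)/(Δt)⁵` [cite: LiSinai2008, §10 p. 312] versus `E ∼ C/(τ - t)` [cite: BoldrighiniFrigioMaponi2017, §2] and enstrophy `const (τ - t)^{-5/2}` / `const (τ - t)^{-3}` for `A > 0` / `A < 0` [cite: BoldrighiniEtAl2023, §2 p. 114]; none is vendored; (j) (audit 2026-08-16) rigorous complex blow-up is printed only for the (near) swirl-free fixed point `H⁽⁰⁾`; other fixed points `(3.4)`, swirl profiles `H_α` and non-fixed-point data blow up numerically only [cite: BoldrighiniEtAl2023, §3 pp. 115–116].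
status: established in the sense of the source — renormalisation-group construction with computer-numerical steps [cite: LiSinai2008, §7 p. 302] and an informal last step [cite: LiSinai2008, §10 p. 312]; uncontested in print [cite: LemarieRieusset2016, §11.2 p. 313] and reproduced numerically [cite: BoldrighiniEtAl2023, §3]; not discharged here; audited 2026-08-14 (statement: `LiSinaiCriticalEnergyBlowupNarrow`) and 2026-08-16 (technique class confirmed, evasions (1)–(3) sharpened) -/
def ComplexNavierStokesBlowup : Prop :=
  ∃ (v₀ : ℝ³ → ℝ³) (t : ℝ) (v : ℝ → ℝ³ → ℝ³), 0 < t ∧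
    Measurable v₀ ∧ HasCompactSupport v₀ ∧ (∃ M : ℝ, ∀ k, ‖v₀ k‖ ≤ M) ∧ (∀ k, ⟪v₀ k, k⟫ = 0) ∧
    v 0 = v₀ ∧
    (∀ τ ∈ Ico 0 t, ∀ k : ℝ³, k ≠ 0 → SolvesFourierNSAt v τ k) ∧
    (∀ τ ∈ Ico 0 t, AEMeasurable (v τ) ∧ ∫⁻ k, ‖v τ k‖ₑ ^ 2 < ∞) ∧
    Tendsto (fun τ => ∫⁻ k, ‖v τ k‖ₑ ^ 2) (𝓝[<] t) (𝓝 ∞)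

/-- Extraction lemma (a consequence of the fact, not a statement of the source): a blow-up
time `t > 0` and a Fourier-side solution `v` of Li–Sinai's integral equation (1) at every
`τ ∈ [0,t)` and `k ≠ 0`, with finite energy at every `τ < t` and energy tending to `+∞` as
`τ ↑ t`. Unlike the bare energy clauses, this conclusion is not provable without the fact (the
identity at `k ≠ 0` ties `v τ` to `v` on `[0,τ)`). [folklore] -/
theorem ComplexNavierStokesBlowup.exists_blowup_solution (h : ComplexNavierStokesBlowup) :
    ∃ (t : ℝ) (v : ℝ → ℝ³ → ℝ³), 0 < t ∧
      (∀ τ ∈ Ico 0 t, ∀ k : ℝ³, k ≠ 0 → SolvesFourierNSAt v τ k) ∧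
      (∀ τ ∈ Ico 0 t, ∫⁻ k, ‖v τ k‖ₑ ^ 2 < ∞) ∧
      Tendsto (fun τ => ∫⁻ k, ‖v τ k‖ₑ ^ 2) (𝓝[<] t) (𝓝 ∞) := by
  obtain ⟨v₀, t, v, ht, -, -, -, -, -, hsol, hfin, hblow⟩ := h
  exact ⟨t, v, ht, hsol, fun τ hτ => (hfin τ hτ).2, hblow⟩

end Literature.Barriers.NavierStokesRegularity
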